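import Literature.NumberTheory.Automorphic.GaloisConjugateGroup
import Literature.NumberTheory.Automorphic.GammaTwoModularFormsBasis
import Literature.NumberTheory.Automorphic.ModularFormAlgebraicLambdaDescent
import Literature.NumberTheory.Automorphic.UnboundedDenominatorsReductions
import HarnessLib

/-!
# Galois conjugation of modular forms of even weight on finite-index subgroups

Fourth file of the analytic proof of the Galois-conjugation input of Calegari–Dimitrov–Tang,
*The unbounded denominators conjecture* (J. Amer. Math. Soc. **38** (2025), arXiv:2109.09040),
Remark 59: **for a modular form `f` of even weight `2k` on a finite-index subgroup
`Γ ≤ SL(2, ℤ)` with strict period `h`, and a field automorphism `σ` of `ℂ`, there is a modular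
form `f'` of weight `2k` on a finite-index subgroup `Γ'` with strict period `h` whose
`q`-expansion at the period `h` is the coefficientwise `σ`-conjugate of that of `f`**
(`exists_conjugate_modularForm_even`).

Proof. `G = f/θ₃^{4k} = f/Uᵏ` is a weight-zero function invariant under the normal core `Γ₀`
of `Γ ∩ Γ(2)`, of exponential type `k` at every cusp (`ModularFormAlgebraicLambda`); with
`L = 2he` such that `T^L ∈ Γ₀` and `s = (UVW)^{2k}` (rational expansion, `Φ s` bounded for all
conjugates `Φ = G ∘ A = (f|A)/(U|A)ᵏ`, `U|A ∈ {±U, ±V, ±W}`) the theorem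
`exists_galois_conjugate_functions` gives the conjugate partner `G'` of `G`, permuted by
`SL(2, ℤ)` compatibly with the `Γ(2)`-orbits and fixed by a finite-index `Γ'`. Then
`f' = G' Uᵏ` is holomorphic, invariant of weight `2k` under `Γ' ∩ Γ(2)`, and bounded at every
cusp: `f'|A = G'_Ψ (U|A)ᵏ = (G'_Ψ s)/w` with `w = s/(U|A)ᵏ` and the order of vanishing of the
expansion of `G'_Ψ s` (the `σ`-conjugate of that of `Ψ s = ±(f|Aγ) w`) at least that of `w`.
Its expansion at the period `L` is `σ` of that of `f` (cancel the rational expansion of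
`s/Uᵏ`), so it is `h`-periodic, and the stabiliser of `f'` is the required `Γ'`.

No definitions, no named facts.

## References

* [CalegariDimitrovTang2025] arXiv:2109.09040, Remark 59.
-/

noncomputable section

open Complex Filter Topology Function Metric Set Polynomial
open UpperHalfPlane hiding I
open scoped Real Topology MatrixGroups Manifold ModularForm

namespace Literature.NumberTheory.Automorphic

namespace ModularLambda

open Literature.NumberTheory.EllipticCurves.JacobiThetaNull
open Literature.NumberTheory.ModularForms (thetaU thetaV thetaW thetaUVW thetaU_apply thetaV_apply
  thetaW_apply thetaU_vadd_one thetaV_vadd_one thetaW_vadd_one thetaU_ne_zero thetaV_ne_zero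
  thetaW_ne_zero mdifferentiable_thetaU mdifferentiable_thetaV mdifferentiable_thetaW
  tendsto_thetaU tendsto_thetaW tendsto_thetaV thetaU_eq_thetaV_add_thetaW slash_T_apply)
open Literature.NumberTheory.ModularForms.QExpansionAlgebra
open ModularGroup Matrix.SpecialLinearGroup

/-! ### Preliminaries on power series -/

/-- A power series has rational coefficients iff it is the image of a series over `ℚ`.
[folklore] -/
theorem forall_coeff_mem_range_ratCast_iff (A : PowerSeries ℂ) :
    (∀ n, A.coeff n ∈ Set.range ((↑) : ℚ → ℂ)) ↔
      ∃ A₀ : PowerSeries ℚ, A = A₀.map (algebraMap ℚ ℂ) := by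
  constructor
  · intro h
    choose q hq using h
    refine ⟨PowerSeries.mk q, ?_⟩
    ext n
    simp [hq n]
  · rintro ⟨A₀, rfl⟩ n
    exact ⟨A₀.coeff n, by simp⟩

/-- If the first `N` coefficients of `B` vanish, so do those of `A * B`. [folklore] -/
theorem PowerSeries.coeff_mul_eq_zero_of_lt {R : Type*} [CommSemiring R] (A B : PowerSeries R)
    {N : ℕ} (hB : ∀ m < N, B.coeff m = 0) : ∀ m < N, (A * B).coeff m = 0 := by
  intro m hm
  rw [PowerSeries.coeff_mul]
  refine Finset.sum_eq_zero fun p hp ↦ ?_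
  have : p.1 + p.2 = m := Finset.HasAntidiagonal.mem_antidiagonal.mp hp
  rw [hB p.2 (by omega), mul_zero]

/-! ### Preliminaries on nice functions -/

/-- **Boundedness of a quotient by orders of vanishing**: if `P, W` are nice, the first `N`
coefficients of both vanish and the `N`-th coefficient of `W` does not, then `P/W` is bounded
at `i∞`. [folklore] -/
theorem isBoundedAtImInfty_div_of_coeff_eq_zero {P W : ℍ → ℂ} {H : ℝ} (hH : 0 < H)
    (hP : Periodic (P ∘ ofComplex) H ∧ MDiff P ∧ IsBoundedAtImInfty P)
    (hW : Periodic (W ∘ ofComplex) H ∧ MDiff W ∧ IsBoundedAtImInfty W) {N : ℕ}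
    (hP0 : ∀ m < N, (qExpansion H P).coeff m = 0) (hW0 : ∀ m < N, (qExpansion H W).coeff m = 0)
    (hWN : (qExpansion H W).coeff N ≠ 0) :
    IsBoundedAtImInfty (fun τ ↦ P τ / W τ) := by
  obtain ⟨P₁, hP₁, hPP₁, -⟩ := exists_eq_qParam_pow_mul_of_coeff_eq_zero hH hP hP0
  obtain ⟨W₁, hW₁, hWW₁, hWexp⟩ := exists_eq_qParam_pow_mul_of_coeff_eq_zero hH hW hW0
  have h0 : (qExpansion H W₁).coeff 0 ≠ 0 := by
    have := congrArg (PowerSeries.coeff N) hWexp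
    rw [PowerSeries.coeff_X_pow_mul'] at this
    simp only [le_refl, if_true, Nat.sub_self] at this
    rwa [this] at hWN
  have heq : (fun τ ↦ P τ / W τ) = fun τ ↦ P₁ τ / W₁ τ := by
    funext τ
    rw [hPP₁ τ, hWW₁ τ, mul_div_mul_left _ _ (pow_ne_zero _ (Periodic.qParam_ne_zero _))]
  rw [heq]
  exact isBoundedAtImInfty_div_of_nice hH hP₁ hW₁ h0

/-- A nice non-zero function has a first non-vanishing coefficient. [folklore] -/
theorem exists_coeff_ne_zero_of_ne {W : ℍ → ℂ} {H : ℝ} (hH : 0 < H)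
    (hW : Periodic (W ∘ ofComplex) H ∧ MDiff W ∧ IsBoundedAtImInfty W) (hW0 : ∃ τ, W τ ≠ 0) :
    ∃ N, (∀ m < N, (qExpansion H W).coeff m = 0) ∧ (qExpansion H W).coeff N ≠ 0 := by
  classical
  have hex : ∃ n, (qExpansion H W).coeff n ≠ 0 := by
    by_contra h
    push Not at h
    have hz : qExpansion H W = qExpansion H (0 : ℍ → ℂ) := by
      rw [qExpansion_zero]; ext n; simp [h n]
    have := eq_of_qExpansion_eq hH hW (nice_zero H) hz
    obtain ⟨τ, hτ⟩ := hW0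
    exact hτ (by rw [this]; rfl)
  exact ⟨Nat.find hex, fun m hm ↦ by simpa using Nat.find_min hex hm, Nat.find_spec hex⟩

/-- **Periodicity from the support of the expansion**: a nice function of period `nH` whose
expansion is supported on multiples of `n` is `H`-periodic. [folklore] -/
theorem vadd_eq_of_coeff_eq_zero {F : ℍ → ℂ} {H : ℝ} {n : ℕ} (hn : n ≠ 0) (hH : 0 < H)
    (hF : Periodic (F ∘ ofComplex) ((n : ℝ) * H : ℝ) ∧ MDiff F ∧ IsBoundedAtImInfty F)
    (hsupp : ∀ m, ¬ n ∣ m → (qExpansion ((n : ℝ) * H) F).coeff m = 0) (τ : ℍ) :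
    F ((H : ℝ) +ᵥ τ) = F τ := by
  have hnH : (0 : ℝ) < n * H := mul_pos (Nat.cast_pos.mpr (Nat.pos_of_ne_zero hn)) hH
  have h1 := hasSum_qExpansion hnH hF.1 hF.2.1 hF.2.2 ((H : ℝ) +ᵥ τ)
  have h2 := hasSum_qExpansion hnH hF.1 hF.2.1 hF.2.2 τ
  set ζ : ℂ := cexp (2 * π * Complex.I / n) with hζ
  have hζn : ζ ^ n = 1 := by
    rw [hζ, ← Complex.exp_nat_mul, mul_div_cancel₀ _ (Nat.cast_ne_zero.mpr hn), Complex.exp_two_pi_mul_I]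
  have hq : Periodic.qParam ((n : ℝ) * H) (((H : ℝ) +ᵥ τ : ℍ) : ℂ) = ζ * Periodic.qParam ((n : ℝ) * H) τ := by
    rw [coe_vadd, hζ, Periodic.qParam, Periodic.qParam, ← Complex.exp_add]
    congr 1
    have hH0 : (H : ℂ) ≠ 0 := ofReal_ne_zero.mpr hH.ne'
    have hn0 : (n : ℂ) ≠ 0 := Nat.cast_ne_zero.mpr hn
    push_cast
    field_simp
  rw [hq] at h1
  have h3 : HasSum (fun m ↦ (qExpansion ((n : ℝ) * H) F).coeff m • Periodic.qParam ((n : ℝ) * H) τ ^ m)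
      (F ((H : ℝ) +ᵥ τ)) := by
    convert h1 using 1
    funext m
    by_cases hm : n ∣ m
    · obtain ⟨j, rfl⟩ := hm
      simp only [mul_pow, pow_mul, hζn, one_mul]
    · rw [hsupp m hm, zero_smul, zero_smul]
  exact h3.unique h2

/-- The slash action of `Tⁿ` is translation by `n`. [folklore] -/
theorem slash_T_pow_apply (F : ℍ → ℂ) (k : ℤ) (n : ℕ) (τ : ℍ) :
    (F ∣[k] (ModularGroup.T ^ n)) τ = F ((n : ℝ) +ᵥ τ) := by
  induction n generalizing τ with
  | zero => simp
  | succ n ih =>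
    rw [pow_succ, SlashAction.slash_mul, slash_T_apply, ih, vadd_vadd]
    congr 1
    push_cast
    ring_nf

/-- The stabiliser of a function under the weight-`k` slash action of `SL(2, ℤ)`, as a subgroup.
[folklore] -/
theorem exists_subgroup_slash_eq (F : ℍ → ℂ) (k : ℤ) :
    ∃ K : Subgroup SL(2, ℤ), ∀ A : SL(2, ℤ), A ∈ K ↔ F ∣[k] A = F := by
  refine ⟨{ carrier := {A | F ∣[k] A = F}
            mul_mem' := fun {a b} ha hb ↦ by
              simp only [Set.mem_setOf_eq] at ha hb ⊢
              rw [SlashAction.slash_mul, ha, hb]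
            one_mem' := by
              simp only [Set.mem_setOf_eq]
              exact SlashAction.slash_one _ _
            inv_mem' := fun {a} ha ↦ by
              simp only [Set.mem_setOf_eq] at ha ⊢
              have h := SlashAction.slash_mul k a a⁻¹ F
              rw [mul_inv_cancel, SlashAction.slash_one, ha] at h
              exact h.symm }, fun A ↦ Iff.rfl⟩

/-! ### The theta functions `U, V, W` -/

/-- `U, V, W` are `1`-antiperiodic-permuted: `U(τ+2) = U(τ)`, etc.; here: each of `U, V, W` is a
nice function of every period `2h`, and `V = λ U`, `W = U − V`. [folklore] -/
theorem nice_thetaUVW (h : ℕ) :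
    (Periodic (thetaU ∘ ofComplex) (((h : ℝ) * 2 : ℝ) : ℂ) ∧ MDiff thetaU ∧ IsBoundedAtImInfty thetaU) ∧
    (Periodic (thetaV ∘ ofComplex) (((h : ℝ) * 2 : ℝ) : ℂ) ∧ MDiff thetaV ∧ IsBoundedAtImInfty thetaV) ∧
    (Periodic (thetaW ∘ ofComplex) (((h : ℝ) * 2 : ℝ) : ℂ) ∧ MDiff thetaW ∧ IsBoundedAtImInfty thetaW) := by
  have hU : thetaU = (fun τ : ℍ ↦ theta3 τ) ^ 4 := by
    funext τ; simp [thetaU_apply]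
  have hV : thetaV = (fun τ : ℍ ↦ modularLambda τ) * thetaU := by
    funext τ
    rw [Pi.mul_apply, modularLambda, thetaU_apply, thetaV_apply,
      div_mul_cancel₀ _ (pow_ne_zero 4 (theta3_ne_zero τ.im_pos))]
  have hW : thetaW = thetaU - thetaV := by
    rw [thetaU_eq_thetaV_add_thetaW]; abel
  have nU : Periodic (thetaU ∘ ofComplex) (((h : ℝ) * 2 : ℝ) : ℂ) ∧ MDiff thetaU ∧
      IsBoundedAtImInfty thetaU := by
    rw [hU]; exact nice_pow (nice_theta3 h) 4
  have nV : Periodic (thetaV ∘ ofComplex) (((h : ℝ) * 2 : ℝ) : ℂ) ∧ MDiff thetaV ∧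
      IsBoundedAtImInfty thetaV := by
    rw [hV]; exact nice_mul (nice_modularLambda h) nU
  exact ⟨nU, nV, by rw [hW]; exact nice_sub nU nV⟩

/-- The expansions of `U, V, W` at the period `2h` have rational coefficients. [folklore] -/
theorem thetaUVW_coeff_mem_range {h : ℕ} (hh : 0 < h) :
    (∀ n, (qExpansion ((h : ℝ) * 2) thetaU).coeff n ∈ Set.range ((↑) : ℚ → ℂ)) ∧
    (∀ n, (qExpansion ((h : ℝ) * 2) thetaV).coeff n ∈ Set.range ((↑) : ℚ → ℂ)) ∧
    (∀ n, (qExpansion ((h : ℝ) * 2) thetaW).coeff n ∈ Set.range ((↑) : ℚ → ℂ)) := by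
  have hH : (0 : ℝ) < (h : ℝ) * 2 := by positivity
  obtain ⟨nU, nV, nW⟩ := nice_thetaUVW h
  have hU : thetaU = (fun τ : ℍ ↦ theta3 τ) ^ 4 := by
    funext τ; simp [thetaU_apply]
  have hV : thetaV = (fun τ : ℍ ↦ modularLambda τ) * thetaU := by
    funext τ
    rw [Pi.mul_apply, modularLambda, thetaU_apply, thetaV_apply,
      div_mul_cancel₀ _ (pow_ne_zero 4 (theta3_ne_zero τ.im_pos))]
  have hW : thetaW = thetaU - thetaV := by
    rw [thetaU_eq_thetaV_add_thetaW]; abel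
  -- `θ₃` and `λ` are images of rational series
  have hΘ : ∃ A₀ : PowerSeries ℚ, qExpansion ((h : ℝ) * 2) (fun τ : ℍ ↦ theta3 τ) =
      A₀.map (algebraMap ℚ ℂ) := by
    rw [← forall_coeff_mem_range_ratCast_iff]
    intro n
    obtain ⟨a, -, -, ha⟩ := exists_coeff_qExpansion_theta3_eq hh
    rw [ha n]
    split_ifs
    · exact ⟨a (n / h), by simp⟩
    · exact ⟨0, by simp⟩
  have hΛ : ∃ A₀ : PowerSeries ℚ, qExpansion ((h : ℝ) * 2) (fun τ : ℍ ↦ modularLambda τ) =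
      A₀.map (algebraMap ℚ ℂ) := by
    rw [← forall_coeff_mem_range_ratCast_iff]
    intro n
    obtain ⟨Lz, -, -, hL⟩ := exists_coeff_qExpansion_modularLambda_eq hh
    rw [hL n]
    split_ifs
    · exact ⟨16 * ((PowerSeries.coeff (n / h) Lz : ℤ) : ℚ), by push_cast; ring⟩
    · exact ⟨0, by simp⟩
  obtain ⟨Θ₀, hΘ₀⟩ := hΘ
  obtain ⟨Λ₀, hΛ₀⟩ := hΛ
  have hUexp : qExpansion ((h : ℝ) * 2) thetaU = (Θ₀ ^ 4).map (algebraMap ℚ ℂ) := by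
    rw [hU, qExpansion_pow_of_nice hH (nice_theta3 h), hΘ₀, map_pow]
  have hVexp : qExpansion ((h : ℝ) * 2) thetaV = (Λ₀ * Θ₀ ^ 4).map (algebraMap ℚ ℂ) := by
    rw [hV, qExpansion_mul_of_nice hH (nice_modularLambda h) nU, hUexp, hΛ₀, map_mul]
  have hWexp : qExpansion ((h : ℝ) * 2) thetaW = (Θ₀ ^ 4 - Λ₀ * Θ₀ ^ 4).map (algebraMap ℚ ℂ) := by
    rw [hW, qExpansion_sub_of_nice hH nU nV, hUexp, hVexp, map_sub]
  exact ⟨(forall_coeff_mem_range_ratCast_iff _).mpr ⟨_, hUexp⟩,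
    (forall_coeff_mem_range_ratCast_iff _).mpr ⟨_, hVexp⟩,
    (forall_coeff_mem_range_ratCast_iff _).mpr ⟨_, hWexp⟩⟩

/-- Products and powers of series with rational coefficients have rational coefficients.
[folklore] -/
theorem coeff_mul_mem_range_ratCast {A B : PowerSeries ℂ}
    (hA : ∀ n, A.coeff n ∈ Set.range ((↑) : ℚ → ℂ)) (hB : ∀ n, B.coeff n ∈ Set.range ((↑) : ℚ → ℂ)) :
    ∀ n, (A * B).coeff n ∈ Set.range ((↑) : ℚ → ℂ) := by
  obtain ⟨A₀, rfl⟩ := (forall_coeff_mem_range_ratCast_iff A).mp hA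
  obtain ⟨B₀, rfl⟩ := (forall_coeff_mem_range_ratCast_iff B).mp hB
  rw [forall_coeff_mem_range_ratCast_iff]
  exact ⟨A₀ * B₀, by rw [map_mul]⟩

/-- Powers of series with rational coefficients have rational coefficients. [folklore] -/
theorem coeff_pow_mem_range_ratCast {A : PowerSeries ℂ}
    (hA : ∀ n, A.coeff n ∈ Set.range ((↑) : ℚ → ℂ)) (m : ℕ) :
    ∀ n, (A ^ m).coeff n ∈ Set.range ((↑) : ℚ → ℂ) := by
  obtain ⟨A₀, rfl⟩ := (forall_coeff_mem_range_ratCast_iff A).mp hA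
  rw [forall_coeff_mem_range_ratCast_iff]
  exact ⟨A₀ ^ m, by rw [map_pow]⟩

/-- Negatives of series with rational coefficients have rational coefficients. [folklore] -/
theorem coeff_neg_mem_range_ratCast {A : PowerSeries ℂ}
    (hA : ∀ n, A.coeff n ∈ Set.range ((↑) : ℚ → ℂ)) :
    ∀ n, (-A).coeff n ∈ Set.range ((↑) : ℚ → ℂ) := by
  obtain ⟨A₀, rfl⟩ := (forall_coeff_mem_range_ratCast_iff A).mp hA
  rw [forall_coeff_mem_range_ratCast_iff]
  exact ⟨-A₀, by rw [map_neg]⟩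

/-- Each of `±U, ±V, ±W` is invariant of weight `2` under `Γ(2)`. [folklore] -/
theorem slash_eq_of_mem_six_of_mem_Gamma_two {X : ℍ → ℂ}
    (hX : X ∈ ({thetaU, -thetaU, thetaV, -thetaV, thetaW, -thetaW} : Set (ℍ → ℂ)))
    {γ : SL(2, ℤ)} (hγ : γ ∈ CongruenceSubgroup.Gamma 2) : X ∣[(2 : ℤ)] γ = X := by
  have hU := thetaU_slash_of_mem_Gamma_two hγ
  have hV := thetaV_slash_eq_of_mem_Gamma_two hγ
  have hW : thetaW ∣[(2 : ℤ)] γ = thetaW := by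
    have h : thetaW = thetaU + -thetaV := by
      rw [thetaU_eq_thetaV_add_thetaW]; abel
    rw [h, SlashAction.add_slash, SlashAction.neg_slash, hU, hV]
  simp only [Set.mem_insert_iff, Set.mem_singleton_iff] at hX
  rcases hX with rfl | rfl | rfl | rfl | rfl | rfl
  · exact hU
  · rw [SlashAction.neg_slash, hU]
  · exact hV
  · rw [SlashAction.neg_slash, hV]
  · exact hW
  · rw [SlashAction.neg_slash, hW]

/-! ### The main theorem -/

/-- **Galois conjugates of modular forms of even weight on finite-index subgroups.** For
`f ∈ M_{2k}(Γ)`, `Γ ≤ SL(2, ℤ)` of finite index with strict period `h ≥ 1`, and a field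
automorphism `σ` of `ℂ`, there are a finite-index `Γ' ≤ SL(2, ℤ)` with strict period `h` and
`f' ∈ M_{2k}(Γ')` whose `q`-expansion at the period `h` is `σ` applied coefficientwise to that
of `f`. [cite: CalegariDimitrovTang2025, Remark 59 (input: "the conjugates of a modular form
on a finite index subgroup are modular forms on finite index subgroups")] -/
theorem exists_conjugate_modularForm_even {Γ : Subgroup SL(2, ℤ)} [Γ.FiniteIndex] (k : ℕ)
    (f : ModularForm (Γ : Subgroup (GL (Fin 2) ℝ)) (2 * k : ℤ)) {h : ℕ} (hh : 0 < h)
    (hΓ : (h : ℝ) ∈ (Γ : Subgroup (GL (Fin 2) ℝ)).strictPeriods) (σ : ℂ ≃+* ℂ) :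
    ∃ (Γ' : Subgroup SL(2, ℤ)) (_ : Γ'.FiniteIndex)
      (f' : ModularForm (Γ' : Subgroup (GL (Fin 2) ℝ)) (2 * k : ℤ)),
      (h : ℝ) ∈ (Γ' : Subgroup (GL (Fin 2) ℝ)).strictPeriods ∧
      ∀ n, (qExpansion (h : ℝ) f').coeff n = σ ((qExpansion (h : ℝ) f).coeff n) := by
  classical
  set G2 : Subgroup SL(2, ℤ) := CongruenceSubgroup.Gamma 2 with hG2
  -- ### the group `Γ₀` and the weight-zero function `G = f/Uᵏ`
  set Γ₀ : Subgroup SL(2, ℤ) := (Γ ⊓ G2).normalCore with hΓ₀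
  haveI : Γ₀.Normal := Subgroup.normalCore_normal _
  haveI : (Γ ⊓ G2).FiniteIndex := inferInstance
  haveI : Γ₀.FiniteIndex := inferInstance
  have hΓ₀le : Γ₀ ≤ Γ ⊓ G2 := Subgroup.normalCore_le _
  set G : ℍ → ℂ := fun z ↦ f z / theta3 (z : ℂ) ^ (4 * k) with hG
  have hopen : IsOpen {z : ℂ | 0 < z.im} := isOpen_lt continuous_const Complex.continuous_im
  have hGd : MDiff G := by
    refine UpperHalfPlane.mdifferentiable_iff.mpr ((differentiableOn_modularForm_div k f).congr ?_)
    intro z hz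
    simp only [comp_apply, hG, ofComplex_apply_of_im_pos hz]
  have hGinv : ∀ γ ∈ Γ₀, ∀ z : ℍ, G (γ • z) = G z := by
    intro γ hγ z
    obtain ⟨h1, h2⟩ := Subgroup.mem_inf.mp (hΓ₀le hγ)
    exact modularForm_div_smul k f h1 h2 z
  have hgr : ∀ A : SL(2, ℤ), ∃ B Mb : ℝ, ∀ z : ℍ, B ≤ z.im →
      ‖G (A • z)‖ ≤ Mb * Real.exp (π * k * z.im) := fun A ↦ exists_norm_modularForm_div_smul_le k f A
  -- ### the period `L = 2 h e` with `T^L ∈ Γ₀`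
  obtain ⟨e, he, -, hTe⟩ := Γ₀.exists_pow_mem_of_index_ne_zero Subgroup.FiniteIndex.index_ne_zero
    (ModularGroup.T ^ (2 * h))
  set L : ℕ := 2 * h * e with hL
  have hTL : ModularGroup.T ^ L ∈ Γ₀ := by rw [hL, pow_mul]; exact hTe
  have hL1 : 1 < L := by
    rw [hL]; nlinarith
  have hL2 : 2 ∣ L := ⟨h * e, by rw [hL]; ring⟩
  set h₆ : ℕ := h * e with hh₆
  have hh₆pos : 0 < h₆ := Nat.mul_pos hh he
  have hLr : ((L : ℕ) : ℝ) = (h₆ : ℝ) * 2 := by rw [hL, hh₆]; push_cast; ring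
  have hLpos : (0 : ℝ) < L := by exact_mod_cast (zero_lt_one.trans hL1)
  -- ### `U, V, W`, `s = (UVW)^{2k}` and the complements
  obtain ⟨nU, nV, nW⟩ := nice_thetaUVW h₆
  rw [← hLr] at nU nV nW
  obtain ⟨rU, rV, rW⟩ := thetaUVW_coeff_mem_range hh₆pos
  rw [← hLr] at rU rV rW
  set s : ℍ → ℂ := thetaU ^ (2 * k) * thetaV ^ (2 * k) * thetaW ^ (2 * k) with hs_def
  have hs : Periodic (s ∘ ofComplex) L ∧ MDiff s ∧ IsBoundedAtImInfty s :=
    nice_mul (nice_mul (nice_pow nU _) (nice_pow nV _)) (nice_pow nW _)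
  have hs0 : ∀ τ, s τ ≠ 0 := fun τ ↦ by
    simp only [hs_def, Pi.mul_apply, Pi.pow_apply]
    exact mul_ne_zero (mul_ne_zero (pow_ne_zero _ (thetaU_ne_zero τ))
      (pow_ne_zero _ (thetaV_ne_zero τ))) (pow_ne_zero _ (thetaW_ne_zero τ))
  have hs1 : ∀ z : ℍ, s ((1 : ℝ) +ᵥ z) = s z := fun z ↦ by
    simp only [hs_def, Pi.mul_apply, Pi.pow_apply, thetaU_vadd_one, thetaV_vadd_one, thetaW_vadd_one,
      (even_two_mul k).neg_pow]
    ring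
  have hsrat : ∀ n, (qExpansion L s).coeff n ∈ Set.range ((↑) : ℚ → ℂ) := by
    rw [hs_def, qExpansion_mul_of_nice hLpos (nice_mul (nice_pow nU _) (nice_pow nV _)) (nice_pow nW _),
      qExpansion_mul_of_nice hLpos (nice_pow nU _) (nice_pow nV _), qExpansion_pow_of_nice hLpos nU,
      qExpansion_pow_of_nice hLpos nV, qExpansion_pow_of_nice hLpos nW]
    exact coeff_mul_mem_range_ratCast (coeff_mul_mem_range_ratCast (coeff_pow_mem_range_ratCast rU _)
      (coeff_pow_mem_range_ratCast rV _)) (coeff_pow_mem_range_ratCast rW _)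
  -- the complements `w_X = s/Xᵏ` for `X ∈ {±U, ±V, ±W}`
  have hsix : ∀ X ∈ ({thetaU, -thetaU, thetaV, -thetaV, thetaW, -thetaW} : Set (ℍ → ℂ)),
      ∃ w : ℍ → ℂ, (Periodic (w ∘ ofComplex) L ∧ MDiff w ∧ IsBoundedAtImInfty w) ∧
        (∀ n, (qExpansion L w).coeff n ∈ Set.range ((↑) : ℚ → ℂ)) ∧
        (∀ τ, w τ ≠ 0) ∧ s = w * X ^ k := by
    intro X hX
    have hU0 := thetaU_ne_zero; have hV0 := thetaV_ne_zero; have hW0 := thetaW_ne_zero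
    -- the three basic complements
    have key : ∀ (Y Z₁ Z₂ : ℍ → ℂ) (ε : ℂ), ε ^ 2 = 1 →
        (Periodic (Y ∘ ofComplex) L ∧ MDiff Y ∧ IsBoundedAtImInfty Y) →
        (Periodic (Z₁ ∘ ofComplex) L ∧ MDiff Z₁ ∧ IsBoundedAtImInfty Z₁) →
        (Periodic (Z₂ ∘ ofComplex) L ∧ MDiff Z₂ ∧ IsBoundedAtImInfty Z₂) →
        (∀ n, (qExpansion L Y).coeff n ∈ Set.range ((↑) : ℚ → ℂ)) →
        (∀ n, (qExpansion L Z₁).coeff n ∈ Set.range ((↑) : ℚ → ℂ)) →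
        (∀ n, (qExpansion L Z₂).coeff n ∈ Set.range ((↑) : ℚ → ℂ)) →
        (∀ τ, Y τ ≠ 0) → (∀ τ, Z₁ τ ≠ 0) → (∀ τ, Z₂ τ ≠ 0) →
        (ε = 1 ∨ ε = -1) →
        s = Y ^ (2 * k) * Z₁ ^ (2 * k) * Z₂ ^ (2 * k) →
        ∃ w : ℍ → ℂ, (Periodic (w ∘ ofComplex) L ∧ MDiff w ∧ IsBoundedAtImInfty w) ∧
          (∀ n, (qExpansion L w).coeff n ∈ Set.range ((↑) : ℚ → ℂ)) ∧
          (∀ τ, w τ ≠ 0) ∧ s = w * (ε • Y) ^ k := by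
      intro Y Z₁ Z₂ ε hε nY nZ₁ nZ₂ rY rZ₁ rZ₂ hY hZ₁ hZ₂ hε' hsY
      refine ⟨(ε ^ k) • (Y ^ k * Z₁ ^ (2 * k) * Z₂ ^ (2 * k)), ?_, ?_, ?_, ?_⟩
      · exact nice_smul _ (nice_mul (nice_mul (nice_pow nY _) (nice_pow nZ₁ _)) (nice_pow nZ₂ _))
      · rw [qExpansion_smul_of_nice hLpos _ (nice_mul (nice_mul (nice_pow nY _) (nice_pow nZ₁ _))
          (nice_pow nZ₂ _)), qExpansion_mul_of_nice hLpos (nice_mul (nice_pow nY _) (nice_pow nZ₁ _))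
          (nice_pow nZ₂ _), qExpansion_mul_of_nice hLpos (nice_pow nY _) (nice_pow nZ₁ _),
          qExpansion_pow_of_nice hLpos nY, qExpansion_pow_of_nice hLpos nZ₁,
          qExpansion_pow_of_nice hLpos nZ₂]
        have hεk : ∀ n, ((ε ^ k) • (qExpansion (L : ℝ) Y ^ k * qExpansion (L : ℝ) Z₁ ^ (2 * k) *
            qExpansion (L : ℝ) Z₂ ^ (2 * k))).coeff n ∈ Set.range ((↑) : ℚ → ℂ) := by
          have hprod := coeff_mul_mem_range_ratCast (coeff_mul_mem_range_ratCast
            (coeff_pow_mem_range_ratCast rY k) (coeff_pow_mem_range_ratCast rZ₁ (2 * k)))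
            (coeff_pow_mem_range_ratCast rZ₂ (2 * k))
          rcases hε' with rfl | rfl
          · simpa using hprod
          · intro n
            rcases neg_one_pow_eq_or ℂ k with h1 | h1
            · rw [h1, one_smul]; exact hprod n
            · rw [h1, neg_one_smul]; exact coeff_neg_mem_range_ratCast hprod n
        exact hεk
      · intro τ
        simp only [Pi.smul_apply, Pi.mul_apply, Pi.pow_apply, smul_eq_mul]
        refine mul_ne_zero (pow_ne_zero _ ?_) (mul_ne_zero (mul_ne_zero (pow_ne_zero _ (hY τ))
          (pow_ne_zero _ (hZ₁ τ))) (pow_ne_zero _ (hZ₂ τ)))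
        rcases hε' with rfl | rfl <;> norm_num
      · rw [hsY]
        funext τ
        simp only [Pi.smul_apply, Pi.mul_apply, Pi.pow_apply, smul_eq_mul, mul_pow]
        have hεk : ε ^ k * ε ^ k = 1 := by rw [← pow_add, ← two_mul, pow_mul, hε, one_pow]
        rw [pow_mul' (Y τ) 2 k, sq]  -- Y^(2k) = (Y^k)? careful
        ring_nf
        rw [show ε ^ (k * 2) = 1 by rw [mul_comm, pow_mul, hε, one_pow]]
        ring
    have hsUVW : s = thetaU ^ (2 * k) * thetaV ^ (2 * k) * thetaW ^ (2 * k) := hs_def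
    have hsVUW : s = thetaV ^ (2 * k) * thetaU ^ (2 * k) * thetaW ^ (2 * k) := by rw [hs_def]; ring
    have hsWUV : s = thetaW ^ (2 * k) * thetaU ^ (2 * k) * thetaV ^ (2 * k) := by rw [hs_def]; ring
    simp only [Set.mem_insert_iff, Set.mem_singleton_iff] at hX
    have h1 : (1 : ℂ) ^ 2 = 1 := one_pow 2
    have hm1 : (-1 : ℂ) ^ 2 = 1 := neg_one_sq
    rcases hX with rfl | rfl | rfl | rfl | rfl | rfl
    · simpa using key thetaU thetaV thetaW 1 h1 nU nV nW rU rV rW hU0 hV0 hW0 (Or.inl rfl) hsUVW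
    · simpa [neg_one_smul] using key thetaU thetaV thetaW (-1) hm1 nU nV nW rU rV rW hU0 hV0 hW0
        (Or.inr rfl) hsUVW
    · simpa using key thetaV thetaU thetaW 1 h1 nV nU nW rV rU rW hV0 hU0 hW0 (Or.inl rfl) hsVUW
    · simpa [neg_one_smul] using key thetaV thetaU thetaW (-1) hm1 nV nU nW rV rU rW hV0 hU0 hW0
        (Or.inr rfl) hsVUW
    · simpa using key thetaW thetaU thetaV 1 h1 nW nU nV rW rU rV hW0 hU0 hV0 (Or.inl rfl) hsWUV
    · simpa [neg_one_smul] using key thetaW thetaU thetaV (-1) hm1 nW nU nV rW rU rV hW0 hU0 hV0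
        (Or.inr rfl) hsWUV
  have hsix_ne : ∀ X ∈ ({thetaU, -thetaU, thetaV, -thetaV, thetaW, -thetaW} : Set (ℍ → ℂ)),
      ∀ τ, X τ ≠ 0 := by
    intro X hX τ
    simp only [Set.mem_insert_iff, Set.mem_singleton_iff] at hX
    rcases hX with rfl | rfl | rfl | rfl | rfl | rfl <;>
      simp [thetaU_ne_zero, thetaV_ne_zero, thetaW_ne_zero]
  -- ### `f|B` and the identity `G(A • z) = (f|A)(z)/(U|A)(z)ᵏ`
  have hfinv : ∀ γ : SL(2, ℤ), γ ∈ Γ → (⇑f) ∣[(2 * k : ℤ)] γ = ⇑f := fun γ hγ ↦ by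
    funext z
    rw [ModularForm.SL_slash_apply, SlashInvariantForm.slash_action_eqn_SL'' f hγ z, mul_comm,
      ← mul_assoc, ← zpow_add₀ (denom_ne_zero _ _), neg_add_cancel, zpow_zero, one_mul]
  have hGslash : ∀ (A : SL(2, ℤ)) (z : ℍ),
      G (A • z) = ((⇑f) ∣[(2 * k : ℤ)] A) z / ((thetaU ∣[(2 : ℤ)] A) z) ^ k := fun A z ↦
    modularForm_div_smul_eq_slash k f A z
  have hnice_slash : ∀ B : SL(2, ℤ), Periodic (((⇑f) ∣[(2 * k : ℤ)] B) ∘ ofComplex) L ∧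
      MDiff ((⇑f) ∣[(2 * k : ℤ)] B) ∧ IsBoundedAtImInfty ((⇑f) ∣[(2 * k : ℤ)] B) := by
    intro B
    refine ⟨periodic_comp_ofComplex_of_vadd_eq fun τ ↦ ?_, ?_, ModularFormClass.bdd_at_infty_slash f B⟩
    · have hconj : B * ModularGroup.T ^ L * B⁻¹ ∈ Γ :=
        (Subgroup.mem_inf.mp (hΓ₀le (Subgroup.Normal.conj_mem inferInstance _ hTL B))).1
      have hT := slash_T_pow_apply ((⇑f) ∣[(2 * k : ℤ)] B) (2 * k : ℤ) L τ
      rw [← hT, ← SlashAction.slash_mul,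
        show B * ModularGroup.T ^ L = B * ModularGroup.T ^ L * B⁻¹ * B by rw [inv_mul_cancel_right],
        SlashAction.slash_mul, hfinv _ hconj]
    · exact (ModularFormClass.holo f).slash _ _
  -- ### boundedness of `(G ∘ A) s`
  have hGs : ∀ A : SL(2, ℤ), IsBoundedAtImInfty ((fun z ↦ G (A • z)) * s) := by
    intro A
    obtain ⟨w, hwn, -, hw0, hsw⟩ := hsix _ (thetaU_slash_mem_six A)
    have hXne := hsix_ne _ (thetaU_slash_mem_six A)
    have heq : (fun z ↦ G (A • z)) * s = ((⇑f) ∣[(2 * k : ℤ)] A) * w := by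
      funext z
      simp only [Pi.mul_apply, hGslash A z, hsw, Pi.pow_apply]
      field_simp [pow_ne_zero k (hXne z)]
    rw [heq]
    exact (ModularFormClass.bdd_at_infty_slash f A).mul hwn.2.2
  -- ### `λ` at the period `L`
  have hlam := nice_modularLambda h₆
  rw [← hLr] at hlam
  have hlamrat : ∀ n, (qExpansion L (fun τ : ℍ ↦ modularLambda τ)).coeff n ∈ Set.range ((↑) : ℚ → ℂ) := by
    intro n
    rw [hLr]
    obtain ⟨z, hz⟩ := coeff_qExpansion_modularLambda_mem hh₆pos n
    exact ⟨z, by rw [hz]; simp⟩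
  -- ### the conjugate functions
  obtain ⟨T, G', Γ', hGT, hTstab, -, hG'prop, -, hR, hΓ'fin, hΓ'inv⟩ :=
    exists_galois_conjugate_functions hGd hGinv k hgr hL1 hL2 hTL hs hs0 hs1 hsrat hGs hlam.1 hlamrat σ
  set F' : ℍ → ℂ := fun z ↦ G' G z * thetaU z ^ k with hF'
  -- ### the key computation at a cusp `A`
  have hslashF' : ∀ (A : SL(2, ℤ)) (z : ℍ),
      (F' ∣[(2 * k : ℤ)] A) z = G' G (A • z) * ((thetaU ∣[(2 : ℤ)] A) z) ^ k := by
    intro A z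
    rw [ModularForm.SL_slash_apply, ModularForm.SL_slash_apply, hF']
    simp only
    rw [mul_pow, ← zpow_natCast (denom (A : GL (Fin 2) ℝ) z ^ (-2 : ℤ)) k, ← zpow_mul]
    ring
  have hbddF' : ∀ A : SL(2, ℤ), IsBoundedAtImInfty (F' ∣[(2 * k : ℤ)] A) := by
    intro A
    set X := thetaU ∣[(2 : ℤ)] A with hXdef
    have hX : X ∈ ({thetaU, -thetaU, thetaV, -thetaV, thetaW, -thetaW} : Set (ℍ → ℂ)) :=
      thetaU_slash_mem_six A
    obtain ⟨w, hwn, -, hw0, hsw⟩ := hsix X hX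
    have hXne := hsix_ne X hX
    obtain ⟨γ, hγ, hRA⟩ := hR A G hGT
    set Ψ : ℍ → ℂ := fun z ↦ G ((A * γ) • z) with hΨ
    have hΨT : Ψ ∈ T := hTstab (A * γ) G hGT
    obtain ⟨-, hΨnice, hΨexp⟩ := hG'prop Ψ hΨT
    -- `Ψ s = (f|Aγ) w`
    have hXγ : thetaU ∣[(2 : ℤ)] (A * γ) = X := by
      rw [SlashAction.slash_mul, ← hXdef, slash_eq_of_mem_six_of_mem_Gamma_two hX hγ]
    have hΨs : Ψ * s = ((⇑f) ∣[(2 * k : ℤ)] (A * γ)) * w := by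
      funext z
      simp only [Pi.mul_apply, hΨ, hGslash (A * γ) z, hXγ, hsw, Pi.pow_apply]
      field_simp [pow_ne_zero k (hXne z)]
    -- orders of vanishing
    obtain ⟨N, hwN0, hwN⟩ := exists_coeff_ne_zero_of_ne hLpos hwn ⟨UpperHalfPlane.I, hw0 _⟩
    have hΨs0 : ∀ m < N, (qExpansion L (Ψ * s)).coeff m = 0 := by
      rw [hΨs, qExpansion_mul_of_nice hLpos (hnice_slash (A * γ)) hwn]
      exact PowerSeries.coeff_mul_eq_zero_of_lt _ _ hwN0
    have hG's0 : ∀ m < N, (qExpansion L (G' Ψ * s)).coeff m = 0 := by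
      intro m hm
      rw [hΨexp, PowerSeries.coeff_map, hΨs0 m hm, map_zero]
    have hbdd := isBoundedAtImInfty_div_of_coeff_eq_zero hLpos hΨnice hwn hG's0 hwN0 hwN
    have heq : F' ∣[(2 * k : ℤ)] A = fun z ↦ (G' Ψ * s) z / w z := by
      funext z
      rw [hslashF' A z, show G' G (A • z) = G' Ψ z from congrFun hRA z, Pi.mul_apply, hsw]
      simp only [Pi.mul_apply, Pi.pow_apply]
      field_simp [hw0 z]
      rw [hXdef]
    rw [heq]
    exact hbdd
  -- ### `F'` is nice of period `L`, with expansion `σ (qExpansion L f)`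
  obtain ⟨w₁, hw₁n, hw₁rat, hw₁0, hsw₁⟩ := hsix thetaU (by simp)
  have hF'd : MDiff F' := ((hG'prop G hGT).1).mul (mdifferentiable_thetaU.pow k)
  have hF'w₁ : F' * w₁ = G' G * s := by
    funext z
    simp only [Pi.mul_apply, hF', hsw₁, Pi.pow_apply]
    ring
  have hfw₁ : (⇑f) * w₁ = G * s := by
    funext z
    simp only [Pi.mul_apply, hG, hsw₁, Pi.pow_apply, thetaU_apply, ← pow_mul]
    field_simp [pow_ne_zero (4 * k) (theta3_ne_zero z.im_pos)]
  have hF'per : Periodic (F' ∘ ofComplex) L := by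
    have h1 : F' = fun z ↦ (G' G * s) z / w₁ z := by
      funext z; rw [← hF'w₁, Pi.mul_apply, mul_div_cancel_right₀ _ (hw₁0 z)]
    rw [h1]
    intro x
    have hp := (hG'prop G hGT).2.1.1 x
    have hq := hw₁n.1 x
    simp only [comp_apply] at hp hq ⊢
    rw [hp, hq]
  have hF'bdd : IsBoundedAtImInfty F' := by
    have := hbddF' 1
    rwa [SlashAction.slash_one] at this
  have hF'nice : Periodic (F' ∘ ofComplex) L ∧ MDiff F' ∧ IsBoundedAtImInfty F' :=
    ⟨hF'per, hF'd, hF'bdd⟩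
  have hfnice : Periodic ((⇑f) ∘ ofComplex) L ∧ MDiff ⇑f ∧ IsBoundedAtImInfty ⇑f := by
    have := hnice_slash 1
    rwa [SlashAction.slash_one] at this
  have hqw₁ : qExpansion L w₁ ≠ 0 := by
    intro h0
    have : w₁ = 0 := eq_of_qExpansion_eq hLpos hw₁n (nice_zero L) (by rw [h0, qExpansion_zero])
    exact hw₁0 UpperHalfPlane.I (by rw [this]; rfl)
  have hexpF' : qExpansion L F' = (qExpansion L ⇑f).map (σ : ℂ →+* ℂ) := by
    have h1 : qExpansion L F' * qExpansion L w₁ = qExpansion L (G' G * s) := by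
      rw [← qExpansion_mul_of_nice hLpos hF'nice hw₁n, hF'w₁]
    have h2 : qExpansion L (G * s) = qExpansion L ⇑f * qExpansion L w₁ := by
      rw [← hfw₁, qExpansion_mul_of_nice hLpos hfnice hw₁n]
    rw [(hG'prop G hGT).2.2, h2, map_mul,
      PowerSeries.map_eq_self_of_forall_coeff_ratCast (σ : ℂ →+* ℂ) hw₁rat] at h1
    exact mul_right_cancel₀ hqw₁ h1
  -- ### `h`-periodicity of `F'`
  have h2e : ((2 * e : ℕ) : ℝ) * (h : ℝ) = (L : ℝ) := by rw [hL]; push_cast; ring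
  have h2e0 : 2 * e ≠ 0 := by omega
  have hhr : (0 : ℝ) < h := Nat.cast_pos.mpr hh
  have hsuppf : ∀ m, ¬ 2 * e ∣ m → (qExpansion (L : ℝ) ⇑f).coeff m = 0 := by
    intro m hm
    rw [← h2e, qExpansion_coeff_natMul f hhr hΓ h2e0 m, if_neg hm]
  have hF'per_h : ∀ τ : ℍ, F' ((h : ℝ) +ᵥ τ) = F' τ := by
    refine vadd_eq_of_coeff_eq_zero h2e0 hhr (by rw [h2e]; exact hF'nice) fun m hm ↦ ?_
    rw [h2e, hexpF', PowerSeries.coeff_map, hsuppf m hm, map_zero]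
  -- ### the group `K` and the modular form
  obtain ⟨K, hK⟩ := exists_subgroup_slash_eq F' (2 * k : ℤ)
  have hΓ'K : Γ' ⊓ G2 ≤ K := by
    intro γ hγ
    obtain ⟨hγ1, hγ2⟩ := Subgroup.mem_inf.mp hγ
    rw [hK]
    funext z
    rw [hslashF' γ z, hΓ'inv γ hγ1 G hGT z, thetaU_slash_of_mem_Gamma_two hγ2]
  haveI : (Γ' ⊓ G2).FiniteIndex := by
    haveI := hΓ'fin
    infer_instance
  haveI hKfi : K.FiniteIndex := Subgroup.finiteIndex_of_le hΓ'K
  have hThK : ModularGroup.T ^ h ∈ K := by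
    rw [hK]
    funext z
    rw [slash_T_pow_apply, hF'per_h]
  let fK : ModularForm (K : Subgroup (GL (Fin 2) ℝ)) (2 * k : ℤ) :=
    { toFun := F'
      slash_action_eq' := by
        intro γ hγ
        obtain ⟨A, hA, rfl⟩ := Subgroup.mem_map.mp hγ
        exact (hK A).mp hA
      holo' := hF'd
      bdd_at_cusps' := by
        intro c hc
        rw [Subgroup.IsArithmetic.isCusp_iff_isCusp_SL2Z] at hc
        rw [OnePoint.isBoundedAt_iff_forall_SL2Z hc]
        intro g _
        exact hbddF' g }
  have hKper : (h : ℝ) ∈ ((K : Subgroup (GL (Fin 2) ℝ))).strictPeriods :=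
    mem_strictPeriods_of_T_pow_mem hThK
  refine ⟨K, hKfi, fK, hKper, fun n ↦ ?_⟩
  have hcoe : (⇑fK : ℍ → ℂ) = F' := rfl
  rw [qExpansion_coeff_eq_coeff_natMul fK hhr hKper h2e0 n,
    qExpansion_coeff_eq_coeff_natMul f hhr hΓ h2e0 n, h2e, hcoe, hexpF', PowerSeries.coeff_map]
  rfl

end ModularLambda

end Literature.NumberTheory.Automorphic
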